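import Summits.ResolutionOfSingularities.ResolutionOfSingularities.Theorems.PurelyInseparableDim4JointForestNormalised
import HarnessLib

/-!
# Purely inseparable four-folds: NAMES for the node data of the joint forest with waiting members (brick S3 (c) «joint
# point∘coordinate chains», part 49 = v3 threading, definitions; cell `res-dim4-pi`)

[OURS · counted 0] (D-0157 DOOR 2; desk WORD #66 (4)(c), #74 (g), #99 (d); frame `PIDim4.TerminationImpliesOrderReduction`, S3 (c) v3;
host item stmt-ResolutionOfSingularities-16155, helper). Nothing here proves resolution of singularities in dimension ≥ 4 / characteristic
`p` — NOT here, not anywhere in this programme. NO theorem here: four ABBREVIATING DEFINITIONS (predicates with explicit parameters, no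
axioms, no cited fact) so that the node theorem with waiting members at arbitrary hosts (memo `S3c-V3LITE-LANDED.md`, successor item 4)
can be STATED within the 400-line file limit — part 20's node theorem spells the same blocks out inline (≈ 70 lines per occurrence).

* `V2Block p plan leaves q` — part 14/20's hereditary v2 conditions at a pair `q = (s, S)`: admissible entries (P1), separated entries (P2),
  leaf point walks (P3), two-way normalised cover (P5);
* `waitingSet wt` — the translated linear subspace `{x | x_i − c_i ∈ 𝔭_x (i ∈ T)}` of `𝔸⁵` of a waiting entry `wt = (j, c, T)`;
* `PointData M′ x s` — part 14/20's data of a point member `x` with state `s` (clean, order, point walk, finiteness, zigzag chart at `x`);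
* `MemberChart M′ c s S Wt wreg` — part 14/20's chart clause of a coordinate member `c` (zigzag chart reading `(z^p + s.F)·𝒪` and `𝓘Λ S`,
  ranges, translated boundary shape) EXTENDED by the waiting regions it hosts: `wreg wt = φ(ψ⁻¹ waitingSet wt)` and `waitingSet wt ⊆ ψ(Y)`
  for `wt ∈ Wt` (parts 44/37e/47 consume exactly these).

AI-produced formalisation, weaker than expert review. bears_on: LADDER-RESOLUTION:D157-DOOR2 (res-dim4-pi · S3 (c) joint v3 · threading defs).
-/

set_option linter.dupNamespace false -- D-0017: single-problem summit path `Summit.<S>.<S>.…` by design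

noncomputable section

open MvPolynomial Finset CategoryTheory AlgebraicGeometry Opposite TopologicalSpace
open AlgebraicGeometry.Scheme.IdealSheafData (ofIdealTop vanishingIdeal)

namespace Summit.ResolutionOfSingularities.ResolutionOfSingularities.Theorems.PIDim4

open Literature.AlgebraicGeometry.Resolution
open Literature.AlgebraicGeometry.Resolution.Hauser2010
open Literature.AlgebraicGeometry.Resolution.AffinePointBlowup (P A γ coord Wtop ξ)

namespace Equimultiple

section Defs

variable {K : Type} [Field K] (p : ℕ) [DecidableEq K]

/-- **The v2 hereditary block at a pair `q = (s, S)`** (part 14/20, spelled out there inline): (P1) every plan entry `(j, b, S″)` has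
`j ∈ S`, `b_j = 0`, `S ⊆ S″`, `(j, b)` equimultiple, `S″` permissible for the child state; (P2) distinct entries are separated; (P3) every
equimultiple leaf has a well-founded, finitely branching point walk; (P5) every NORMALISED equimultiple pair agrees with an entry of its
chart on `S″` or is a leaf. [cite: BierstoneGrigorievMilmanWlodarczyk2011, Def. 3.1.3; §4 Step 2b] -/
def V2Block (plan : State K → Finset (Fin 4) → Finset (Fin 4 × (Fin 4 → K) × Finset (Fin 4)))
    (leaves : State K → Finset (Fin 4) → Finset (Fin 4 × (Fin 4 → K))) (q : State K × Finset (Fin 4)) : Prop :=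
  (∀ e ∈ plan q.1 q.2, e.1 ∈ q.2 ∧ e.2.1 e.1 = 0 ∧ q.2 ⊆ e.2.2 ∧
      CentreBlowup.IsEquimultiplePoint p q.2 e.1 e.2.1 q.1 ∧
      IsPermissibleCentre p e.2.2 (CentreBlowup.step p q.2 e.1 e.2.1 q.1).F) ∧
  (∀ e ∈ plan q.1 q.2, ∀ e' ∈ plan q.1 q.2, e ≠ e' →
      (e.1 = e'.1 ∧ ∃ i ∈ e.2.2, i ∈ e'.2.2 ∧ e.2.1 i ≠ e'.2.1 i) ∨
      (e.1 ≠ e'.1 ∧ ((e'.2.1 e.1 = 0 ∧ e.1 ∈ e'.2.2) ∨ (e.2.1 e'.1 = 0 ∧ e'.1 ∈ e.2.2)))) ∧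
  (∀ l ∈ leaves q.1 q.2, CentreBlowup.IsEquimultiplePoint p q.2 l.1 l.2 q.1 →
      Acc (fun s' s : State K => Edge p Finset.univ s s') (CentreBlowup.step p q.2 l.1 l.2 q.1) ∧
      ∀ s' : State K, Relation.ReflTransGen (fun a e : State K => Edge p Finset.univ a e)
          (CentreBlowup.step p q.2 l.1 l.2 q.1) s' →
        {jb : Fin 4 × (Fin 4 → K) | jb.2 jb.1 = 0 ∧ CentreBlowup.IsEquimultiplePoint p Finset.univ jb.1 jb.2 s'}.Finite) ∧
  (∀ (j' : Fin 4) (b' : Fin 4 → K), j' ∈ q.2 → b' j' = 0 → (∀ k ∈ q.2, k < j' → b' k = 0) →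
      CentreBlowup.IsEquimultiplePoint p q.2 j' b' q.1 →
      (∃ e ∈ plan q.1 q.2, e.1 = j' ∧ ∀ i ∈ e.2.2, b' i = e.2.1 i) ∨ (j', b') ∈ leaves q.1 q.2)

omit [DecidableEq K] in
/-- **The waiting coordinate set** of a waiting entry `wt = (j, c, T)`: the translated linear subspace `{x | x_i − c_i ∈ 𝔭_x (i ∈ T)}` of
`𝔸⁵` (no condition on `z`; host-relative coordinates). [cite: Hauser2010, §G (translated coordinate subspaces)] -/
def waitingSet (wt : Fin 4 × (Fin 4 → K) × Finset (Fin 4)) : Set (P 4 K) :=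
  {x : P 4 K | ∀ i ∈ wt.2.2, (X i.succ - C (wt.2.1 i) : A 4 K) ∈ x.asIdeal}

omit [DecidableEq K] in
/-- Membership in the waiting coordinate set, unfolded. [folklore] -/
theorem mem_waitingSet_iff (wt : Fin 4 × (Fin 4 → K) × Finset (Fin 4)) (x : P 4 K) :
    x ∈ waitingSet wt ↔ ∀ i ∈ wt.2.2, (X i.succ - C (wt.2.1 i) : A 4 K) ∈ x.asIdeal := Iff.rfl

variable {X' : Scheme.{0}}

/-- **Data of a POINT member** `x` of a node `(X′, M′)` with state `s` (part 14/20, spelled out there inline): `s.F ≠ 0` clean of order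
`≥ p` at the origin, a well-founded finitely branching point walk below `s`, and a zigzag chart `X′ ←φ— Y —ψ→ 𝔸⁵` through `x ↦ origin`
reading `M′` as `(z^p + s.F)·𝒪`. [cite: BierstoneGrigorievMilmanWlodarczyk2011, Def. 3.1.3] [cite: Hauser2010, §F] -/
def PointData [IsAlgClosed K] (M' : MarkedIdeal X') (x : X') (s : State K) : Prop :=
  s.F ≠ 0 ∧ Literature.Barriers.ResolutionOfSingularities.HauserPerlega.IsClean p s.F ∧
  (p : ℕ∞) ≤ CentreBlowup.ordAlong (Finset.univ : Finset (Fin 4)) s.F ∧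
  Acc (fun s' s : State K => Edge p Finset.univ s s') s ∧
  (∀ s' : State K, Relation.ReflTransGen (fun a b : State K => Edge p Finset.univ a b) s s' →
    {w' : blowup (Scheme.IdealSheafData.vanishingIdeal (AffinePointBlowup.C₀ 4 K)) |
      IsClosed ({w'} : Set (blowup (Scheme.IdealSheafData.vanishingIdeal (AffinePointBlowup.C₀ 4 K)))) ∧
      blowup.π (Scheme.IdealSheafData.vanishingIdeal (AffinePointBlowup.C₀ 4 K)) w' = ξ 4 K ∧
      (p : ℕ∞) ≤ idealOrder ((⟨hypSheaf p s'.F, [], p⟩ : MarkedIdeal (P 4 K)).transform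
        (blowup.π (Scheme.IdealSheafData.vanishingIdeal (AffinePointBlowup.C₀ 4 K)))
        (Scheme.IdealSheafData.vanishingIdeal (AffinePointBlowup.C₀ 4 K))).ideal w'}.Finite) ∧
  ∃ (Y : Scheme.{0}) (φ : Y ⟶ X') (ψ : Y ⟶ P 4 K) (_ : IsOpenImmersion φ) (_ : IsOpenImmersion ψ) (y : Y),
    φ y = x ∧ ψ y = ξ 4 K ∧ M'.ideal.comap φ = (hypSheaf p s.F).comap ψ

omit [DecidableEq K] in
/-- **Chart clause of a COORDINATE member** `c` of a node `(X′, M′)` with state `s`, centre `S` and WAITING entries `Wt` with regions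
`wreg`: a zigzag chart `X′ ←φ— Y —ψ→ 𝔸⁵` reading `M′` as `(z^p + s.F)·𝒪` and `𝓘(c)` as `𝓘Λ S`, covering `c`, seeing `V(z, x_S)`, carrying the
translated shape of the boundary (part 14/20's clause), AND through which every waiting region is seen: `wreg wt = φ(ψ⁻¹ waitingSet wt)`,
`waitingSet wt ⊆ ψ(Y)` (`wt ∈ Wt`; parts 44/37e/47). [cite: BierstoneGrigorievMilmanWlodarczyk2011, Def. 3.1.3 (2), (4)]
[cite: Hauser2010, §G] -/
def MemberChart (M' : MarkedIdeal X') (c : Closeds X') (s : State K) (S : Finset (Fin 4))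
    (Wt : Finset (Fin 4 × (Fin 4 → K) × Finset (Fin 4))) (wreg : Fin 4 × (Fin 4 → K) × Finset (Fin 4) → Closeds X') : Prop :=
  ∃ (Y : Scheme.{0}) (φ : Y ⟶ X') (ψ : Y ⟶ P 4 K) (_ : IsOpenImmersion φ) (_ : IsOpenImmersion ψ),
    M'.ideal.comap φ = (hypSheaf p s.F).comap ψ ∧
    (vanishingIdeal c).comap φ = (AffineCoordBlowup.𝓘Λ 4 K (insert 0 (Fin.succ '' (S : Set (Fin 4))))).comap ψ ∧
    (c : Set X') ⊆ Set.range φ ∧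
    (AffineCoordBlowup.CΛ 4 K (insert 0 (Fin.succ '' (S : Set (Fin 4)))) : Set (P 4 K)) ⊆ Set.range ψ ∧
    (∃ (idx : X'.IdealSheafData → Fin 4) (cst_ : X'.IdealSheafData → K),
      (∀ D ∈ M'.boundary,
        ((D.support : Set X') ∩ φ '' (ψ ⁻¹'
          (AffineCoordBlowup.CΛ 4 K (insert 0 (Fin.succ '' (S : Set (Fin 4)))) : Set (P 4 K)))).Nonempty →
        D.comap φ = (ofIdealTop (Ideal.span {(γ 4 K).symm (X (idx D).succ + C (cst_ D))})).comap ψ ∧ (idx D ∈ S → cst_ D = 0)) ∧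
      (∀ D₁ ∈ M'.boundary, ∀ D₂ ∈ M'.boundary,
        ((D₁.support : Set X') ∩ φ '' (ψ ⁻¹'
          (AffineCoordBlowup.CΛ 4 K (insert 0 (Fin.succ '' (S : Set (Fin 4)))) : Set (P 4 K)))).Nonempty →
        ((D₂.support : Set X') ∩ φ '' (ψ ⁻¹'
          (AffineCoordBlowup.CΛ 4 K (insert 0 (Fin.succ '' (S : Set (Fin 4)))) : Set (P 4 K)))).Nonempty →
        idx D₁ = idx D₂ → D₁ = D₂)) ∧
    ∀ wt ∈ Wt, (wreg wt : Set X') = φ '' (ψ ⁻¹' waitingSet wt) ∧ waitingSet wt ⊆ Set.range ψ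

omit [DecidableEq K] in
/-- Without waiting entries the chart clause is part 14/20's (the waiting conjunct is vacuous). [folklore] -/
theorem memberChart_empty_iff (M' : MarkedIdeal X') (c : Closeds X') (s : State K) (S : Finset (Fin 4))
    (wreg : Fin 4 × (Fin 4 → K) × Finset (Fin 4) → Closeds X') :
    MemberChart p M' c s S ∅ wreg ↔
      ∃ (Y : Scheme.{0}) (φ : Y ⟶ X') (ψ : Y ⟶ P 4 K) (_ : IsOpenImmersion φ) (_ : IsOpenImmersion ψ),
        M'.ideal.comap φ = (hypSheaf p s.F).comap ψ ∧
        (vanishingIdeal c).comap φ = (AffineCoordBlowup.𝓘Λ 4 K (insert 0 (Fin.succ '' (S : Set (Fin 4))))).comap ψ ∧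
        (c : Set X') ⊆ Set.range φ ∧
        (AffineCoordBlowup.CΛ 4 K (insert 0 (Fin.succ '' (S : Set (Fin 4)))) : Set (P 4 K)) ⊆ Set.range ψ ∧
        ∃ (idx : X'.IdealSheafData → Fin 4) (cst_ : X'.IdealSheafData → K),
          (∀ D ∈ M'.boundary,
            ((D.support : Set X') ∩ φ '' (ψ ⁻¹'
              (AffineCoordBlowup.CΛ 4 K (insert 0 (Fin.succ '' (S : Set (Fin 4)))) : Set (P 4 K)))).Nonempty →
            D.comap φ = (ofIdealTop (Ideal.span {(γ 4 K).symm (X (idx D).succ + C (cst_ D))})).comap ψ ∧ (idx D ∈ S → cst_ D = 0)) ∧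
          (∀ D₁ ∈ M'.boundary, ∀ D₂ ∈ M'.boundary,
            ((D₁.support : Set X') ∩ φ '' (ψ ⁻¹'
              (AffineCoordBlowup.CΛ 4 K (insert 0 (Fin.succ '' (S : Set (Fin 4)))) : Set (P 4 K)))).Nonempty →
            ((D₂.support : Set X') ∩ φ '' (ψ ⁻¹'
              (AffineCoordBlowup.CΛ 4 K (insert 0 (Fin.succ '' (S : Set (Fin 4)))) : Set (P 4 K)))).Nonempty →
            idx D₁ = idx D₂ → D₁ = D₂) := by
  constructor
  · rintro ⟨Y, φ, ψ, _, _, h1, h2, h3, h4, h5, -⟩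
    exact ⟨Y, φ, ψ, inferInstance, inferInstance, h1, h2, h3, h4, h5⟩
  · rintro ⟨Y, φ, ψ, _, _, h1, h2, h3, h4, h5⟩
    exact ⟨Y, φ, ψ, inferInstance, inferInstance, h1, h2, h3, h4, h5, fun wt hwt => absurd hwt (Finset.notMem_empty wt)⟩

end Defs

end Equimultiple

end Summit.ResolutionOfSingularities.ResolutionOfSingularities.Theorems.PIDim4

end
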